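import Literature.Barriers.RiemannHypothesis.EpsteinZetaChowlaSelberg
import Literature.Barriers.RiemannHypothesis.EpsteinZetaConstantTerms
import Literature.Barriers.RiemannHypothesis.EpsteinZetaStarkSetup
import Literature.NumberTheory.Automorphic.EisensteinOrthogonality
import HarnessLib

/-!
# The Fourier expansion of `E(z, s)` for `SL₂(ℤ)`: constant term `y^s + φ(s)y^{1-s}` and the exponentially small remainder, on the whole `s`-plane

Layer 25 of the proof of Selberg's lattice-point theorem for the modular group
(`Literature.NumberTheory.Automorphic.sl2BallCount_asymp`). From the Chowla–Selberg formula PROVED in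
the tree (`Literature.Barriers.RiemannHypothesis.BatemanGrosswald1964_thm1_holds`, Bateman–Grosswald's
Theorem 1 with the `K`-Bessel series `H = bgH`) we derive, for the completed Eisenstein series
`E*(z, s) = Λ_z(s)/2` of `ModularEisensteinContinuation.lean` and ALL `s ∉ {0, ½, 1}`,

  `E*(z, s) = Λ(2s) y^s + Λ(2s - 1) y^{1-s} + √y · H_z(s)`,   `H_z(s) = bgH 1 (2x) (x² + y²) s`

(`completedEisenstein_eq_constantTerm_add`; `Λ = completedRiemannZeta`), i.e. Iwaniec's (3.20)/(3.29)
with `φ(s) = Λ(2s-1)/Λ(2s)` after division by `θ(s) = Λ(2s)`: the constant term of `E(z, s)` along the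
horocycle `{x + iy : 0 ≤ x ≤ 1}` is `y^s + φ(s) y^{1-s}` (`intervalIntegral_eisensteinCrit`, on the
critical line in the normalisation `eisensteinCrit` of `ModularEisensteinCriticalLine.lean`), and the
non-constant part is `O(e^{-2πy})` uniformly in `Im s` for `0 ≤ Re s ≤ 1` (`norm_csH_le`), hence
`|E(z, 1/2 + ir)| ≤ 2√y + |c(r)| C e^{-2πy}` with `c = critFactor` continuous (`norm_eisensteinCrit_le`).
These are the two inputs about `E(z, 1/2 + ir)` needed for the continuous spectrum in Theorem 7.3:
the inner products `⟨E(·|ψ), E(·, 1/2 + ir)⟩` (Iwaniec (7.13)–(7.14)) and the square-integrability of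
Eisenstein wave packets.

## References

* [Iwaniec2002] H. Iwaniec, *Spectral Methods of Automorphic Forms*, 2nd ed., AMS GSM 53 (2002),
  §3.4 (3.20)–(3.31), PDF pp. 45–47 (Fourier expansion of `E(z, s)` for the modular group, `φ(s)`).
* [BatemanGrosswald1964] P. T. Bateman, E. Grosswald, *On Epstein's zeta function*, Acta Arith. 9
  (1964) 365–373, Theorem 1 (the Chowla–Selberg formula), as proved in
  `Literature/Barriers/RiemannHypothesis/EpsteinZetaChowlaSelberg.lean`.
-/

noncomputable section

open MeasureTheory Set Filter Real UpperHalfPlane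
open scoped Topology ComplexConjugate

namespace Literature.NumberTheory.Automorphic

open Literature.Barriers.RiemannHypothesis (IsPosDefForm bgH bgHTerm sigmaC starkK epsteinZeta
  BatemanGrosswald1964_thm1_holds epsteinZeta_swap thetaFEPair_Λ_eq_epsteinZeta starkK_pos
  norm_bgHTerm_le_of_norm_le summable_bgHTerm_succ_of_isPosDefForm differentiable_bgH bgH_one_sub
  norm_sigmaC_le_mul_pow isPreconnected_compl_zero_half_one summable_pow_mul_exp_neg_succ)
open Literature.Analysis.FunctionSpaces (besselK)
open Literature.Analysis.Complex.Polya1926 (polyaM polyaM_nonneg)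

/-! ## The binary quadratic form `|mz + n|² = y · Q_z(m, n)` attached to `z ∈ ℍ` -/

/-- `x² + y² - x² = y²` bookkeeping: `4(x² + y²) - (2x)² = (2y)²`. [folklore] -/
theorem four_normSq_sub_sq (z : ℍ) : 4 * 1 * Complex.normSq (z : ℂ) - (2 * z.re) ^ 2 = (2 * z.im) ^ 2 := by
  rw [Complex.normSq_apply]
  simp only [UpperHalfPlane.coe_re, UpperHalfPlane.coe_im]
  ring

/-- The form `m² + 2x·mn + |z|²n²` (coefficients `(1, 2x, |z|²)`) is positive definite. [folklore] -/
theorem isPosDefForm_upperHalf (z : ℍ) : IsPosDefForm 1 (2 * z.re) (Complex.normSq (z : ℂ)) := by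
  refine ⟨one_pos, ?_⟩
  have h := four_normSq_sub_sq z
  have hy := z.im_pos
  nlinarith

/-- The swapped form `|z|²m² + 2x·mn + n²` is positive definite. [folklore] -/
theorem isPosDefForm_upperHalf' (z : ℍ) : IsPosDefForm (Complex.normSq (z : ℂ)) (2 * z.re) 1 := by
  refine ⟨?_, ?_⟩
  · exact Complex.normSq_pos.mpr (UpperHalfPlane.ne_zero z)
  · have h := four_normSq_sub_sq z
    have hy := z.im_pos
    nlinarith

/-- The discriminant of `(|z|², 2x, 1)`: `4|z|² - 4x² = (2y)²`. [folklore] -/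
theorem disc_upperHalf' (z : ℍ) : 4 * Complex.normSq (z : ℂ) * 1 - (2 * z.re) ^ 2 = (2 * z.im) ^ 2 := by
  rw [Complex.normSq_apply]
  simp only [UpperHalfPlane.coe_re, UpperHalfPlane.coe_im]
  ring

/-- `z = (b + i√D)/(2c)` for the form `(|z|², 2x, 1)`: the imaginary part. [folklore] -/
theorem im_eq_sqrt_disc (z : ℍ) : z.im = Real.sqrt (4 * Complex.normSq (z : ℂ) * 1 - (2 * z.re) ^ 2) / (2 * 1) := by
  rw [disc_upperHalf', Real.sqrt_sq (by have := z.im_pos; positivity)]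
  ring

/-- Stark's parameter of the form `(1, 2x, |z|²)` is `k = y`. [folklore] -/
theorem starkK_upperHalf (z : ℍ) : starkK 1 (2 * z.re) (Complex.normSq (z : ℂ)) = z.im := by
  unfold starkK
  rw [show 4 * (1 : ℝ) * Complex.normSq (z : ℂ) - (2 * z.re) ^ 2 = (2 * z.im) ^ 2 by
    have := four_normSq_sub_sq z; linarith, Real.sqrt_sq (by have := z.im_pos; positivity)]
  ring

/-! ## The Bessel part `H_z(s)` -/

/-- **The non-constant part of the Fourier expansion of `E*(z, s)`** (up to the factor `√y`):
`H_z(s) = 4 Σ_{n ≥ 1} n^{s-½} σ_{1-2s}(n) cos(2πnx) K_{s-½}(2πny)`, Bateman–Grosswald's `H(s)` for the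
form `(1, 2x, |z|²)` (`k = y`, `cos(nπb/a) = cos(2πnx)`). [cite: Iwaniec2002, (3.29), PDF p. 47] -/
def csH (z : ℍ) (s : ℂ) : ℂ := bgH 1 (2 * z.re) (Complex.normSq (z : ℂ)) s

/-- `H_z` is entire. [cite: BatemanGrosswald1964, Theorem 1] -/
theorem differentiable_csH (z : ℍ) : Differentiable ℂ (csH z) :=
  differentiable_bgH (isPosDefForm_upperHalf z)

/-- `H_z(1 - s) = H_z(s)`. [cite: BatemanGrosswald1964, Theorem 1] -/
theorem csH_one_sub (z : ℍ) (s : ℂ) : csH z (1 - s) = csH z s :=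
  bgH_one_sub _ _ _ s

/-! ## `E*(z, s) = Λ(2s) y^s + Λ(2s-1) y^{1-s} + √y H_z(s)` -/

/-- `Γ(½) = √π` as a complex number. [folklore] -/
theorem Gamma_half_eq_sqrt_pi : Complex.Gamma (1 / 2) = ((Real.sqrt π : ℝ) : ℂ) := by
  rw [Complex.Gamma_one_half_eq, Real.sqrt_eq_rpow, Complex.ofReal_cpow Real.pi_pos.le]
  push_cast
  rfl

/-- `Λ(2s - 1) = π^{-s} √π Γ(s - ½) ζ(2s - 1)` for `Re s > ½`. [folklore] -/
theorem completedRiemannZeta_two_mul_sub_one {s : ℂ} (hs : 1 / 2 < s.re) :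
    completedRiemannZeta (2 * s - 1) =
      (π : ℂ) ^ (-s) * ((Real.sqrt π : ℝ) : ℂ) * Complex.Gamma (s - 1 / 2) * riemannZeta (2 * s - 1) := by
  have h := completedRiemannZeta_two_mul (s := s - 1 / 2) (by simp; linarith)
  rw [show 2 * (s - 1 / 2) = 2 * s - 1 by ring] at h
  rw [h]
  have hπ : (π : ℂ) ≠ 0 := by exact_mod_cast Real.pi_pos.ne'
  have e : (π : ℂ) ^ (-(s - 1 / 2)) = (π : ℂ) ^ (-s) * ((Real.sqrt π : ℝ) : ℂ) := by
    rw [show -(s - 1 / 2) = -s + 1 / 2 by ring, Complex.cpow_add _ _ hπ, Real.sqrt_eq_rpow,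
      Complex.ofReal_cpow Real.pi_pos.le]
    push_cast
    rfl
  rw [e]

/-- **The Chowla–Selberg formula in the Eisenstein normalisation, `Re s > 1`**:
`E*(z, s) = Λ(2s) y^s + Λ(2s-1) y^{1-s} + √y H_z(s)` (Iwaniec (3.20) × `θ(s) = Λ(2s)`:
`θ(s)φ(s) = π^{½-s}Γ(s-½)ζ(2s-1) = Λ(2s-1)`). [cite: Iwaniec2002, (3.20)-(3.29), PDF pp. 45-47] -/
theorem completedEisenstein_eq_constantTerm_add_of_one_lt (z : ℍ) {s : ℂ} (hs : 1 < s.re) :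
    completedEisenstein z s =
      completedRiemannZeta (2 * s) * ((z.im : ℝ) : ℂ) ^ s +
        completedRiemannZeta (2 * s - 1) * ((z.im : ℝ) : ℂ) ^ (1 - s) +
          ((Real.sqrt z.im : ℝ) : ℂ) * csH z s := by
  have hy := z.im_pos
  have hyc : ((z.im : ℝ) : ℂ) ≠ 0 := by exact_mod_cast hy.ne'
  have hπ : (π : ℂ) ≠ 0 := by exact_mod_cast Real.pi_pos.ne'
  have hs0 : 0 < s.re := by linarith
  have hΓ : Complex.Gamma s ≠ 0 := Complex.Gamma_ne_zero_of_re_pos hs0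
  -- the bridge `Λ_z(s) = π^{-s} Γ(s) y^s ζ_Q(s)` for `Q = (|z|², 2x, 1)`
  have hre : z.re = 2 * z.re / (2 * 1) := by ring
  have hΛ := thetaFEPair_Λ_eq_epsteinZeta (isPosDefForm_upperHalf' z) z hre (im_eq_sqrt_disc z) hs
  have hD : Real.sqrt (4 * Complex.normSq (z : ℂ) * 1 - (2 * z.re) ^ 2) / 2 = z.im := by
    rw [disc_upperHalf', Real.sqrt_sq (by have := z.im_pos; positivity)]
    ring
  rw [hD] at hΛ
  -- Bateman–Grosswald for the swapped form `(1, 2x, |z|²)`, `k = y`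
  have hBG := (BatemanGrosswald1964_thm1_holds 1 (2 * z.re) (Complex.normSq (z : ℂ)) (isPosDefForm_upperHalf z)).2.2.2 s hs
  rw [starkK_upperHalf, Complex.ofReal_one, Complex.one_cpow, one_mul, epsteinZeta_swap] at hBG
  -- assemble
  have e0 : completedEisenstein z s = (π : ℂ) ^ (-s) * Complex.Gamma s * ((z.im : ℝ) : ℂ) ^ s *
      (epsteinZeta (Complex.normSq (z : ℂ)) (2 * z.re) 1 s / 2) := by
    unfold completedEisenstein
    rw [hΛ]
    ring
  rw [e0, hBG, completedRiemannZeta_two_mul hs0, completedRiemannZeta_two_mul_sub_one (by linarith),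
    Gamma_half_eq_sqrt_pi]
  have e1 : ((z.im : ℝ) : ℂ) ^ s * ((z.im : ℝ) : ℂ) ^ (1 - 2 * s) = ((z.im : ℝ) : ℂ) ^ (1 - s) := by
    rw [← Complex.cpow_add _ _ hyc]; congr 1; ring
  have e2 : ((z.im : ℝ) : ℂ) ^ s * ((z.im : ℝ) : ℂ) ^ (1 / 2 - s) = ((Real.sqrt z.im : ℝ) : ℂ) := by
    rw [← Complex.cpow_add _ _ hyc, show s + (1 / 2 - s) = ((1 / 2 : ℝ) : ℂ) by push_cast; ring,
      ← Complex.ofReal_cpow hy.le, Real.sqrt_eq_rpow]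
  have e3 : (π : ℂ) ^ (-s) * (π : ℂ) ^ s = 1 := by
    rw [Complex.cpow_neg, inv_mul_cancel₀ (Complex.cpow_ne_zero_iff.mpr (Or.inl hπ))]
  have e4 : Complex.Gamma s * (Complex.Gamma s)⁻¹ = 1 := mul_inv_cancel₀ hΓ
  rw [div_eq_mul_inv (Complex.Gamma (s - 1 / 2) * ((Real.sqrt π : ℝ) : ℂ)) (Complex.Gamma s),
    div_eq_mul_inv ((π : ℂ) ^ s) (Complex.Gamma s)]
  unfold csH
  linear_combination ((π : ℂ) ^ (-s) * ((Real.sqrt π : ℝ) : ℂ) * Complex.Gamma (s - 1 / 2) *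
      riemannZeta (2 * s - 1) * ((z.im : ℝ) : ℂ) ^ s * ((z.im : ℝ) : ℂ) ^ (1 - 2 * s)) * e4 +
    ((π : ℂ) ^ (-s) * ((Real.sqrt π : ℝ) : ℂ) * Complex.Gamma (s - 1 / 2) * riemannZeta (2 * s - 1)) * e1 +
    (bgH 1 (2 * z.re) (Complex.normSq (z : ℂ)) s * Complex.Gamma s * (Complex.Gamma s)⁻¹ *
      ((z.im : ℝ) : ℂ) ^ s * ((z.im : ℝ) : ℂ) ^ (1 / 2 - s)) * e3 +
    (bgH 1 (2 * z.re) (Complex.normSq (z : ℂ)) s * ((z.im : ℝ) : ℂ) ^ s * ((z.im : ℝ) : ℂ) ^ (1 / 2 - s)) * e4 +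
    bgH 1 (2 * z.re) (Complex.normSq (z : ℂ)) s * e2


/-- **`E*(z, s) = Λ(2s) y^s + Λ(2s-1) y^{1-s} + √y H_z(s)` for all `s ∉ {0, ½, 1}`** (both sides are
holomorphic off `{0, ½, 1}`; identity theorem from `Re s > 1`). At `s = ½` the two constant terms have
cancelling poles. [cite: Iwaniec2002, (3.20)-(3.31), PDF pp. 45-47] -/
theorem completedEisenstein_eq_constantTerm_add (z : ℍ) {s : ℂ} (h0 : s ≠ 0) (h1 : s ≠ 1) (hh : s ≠ 1 / 2) :
    completedEisenstein z s =
      completedRiemannZeta (2 * s) * ((z.im : ℝ) : ℂ) ^ s +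
        completedRiemannZeta (2 * s - 1) * ((z.im : ℝ) : ℂ) ^ (1 - s) +
          ((Real.sqrt z.im : ℝ) : ℂ) * csH z s := by
  have hy0 : 0 < z.im := z.im_pos
  have hyc : ((z.im : ℝ) : ℂ) ≠ 0 := by exact_mod_cast hy0.ne'
  set U : Set ℂ := {s : ℂ | s ≠ 0 ∧ s ≠ 1 ∧ s ≠ 1 / 2} with hU
  have hUo : IsOpen U := (isOpen_ne.inter (isOpen_ne.inter isOpen_ne))
  set G : ℂ → ℂ := fun s => completedRiemannZeta (2 * s) * ((z.im : ℝ) : ℂ) ^ s +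
      completedRiemannZeta (2 * s - 1) * ((z.im : ℝ) : ℂ) ^ (1 - s) + ((Real.sqrt z.im : ℝ) : ℂ) * csH z s with hG
  have hF : AnalyticOnNhd ℂ (completedEisenstein z) U := by
    apply DifferentiableOn.analyticOnNhd _ hUo
    intro w hw
    exact (differentiableAt_completedEisenstein z hw.1 hw.2.1).differentiableWithinAt
  have hGa : AnalyticOnNhd ℂ G U := by
    apply DifferentiableOn.analyticOnNhd _ hUo
    intro w hw
    apply DifferentiableAt.differentiableWithinAt
    have hw2 : 2 * w ≠ 0 := mul_ne_zero two_ne_zero hw.1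
    have hw2' : 2 * w ≠ 1 := fun h => hw.2.2 (by linear_combination h / 2)
    have hw3 : 2 * w - 1 ≠ 0 := fun h => hw.2.2 (by linear_combination h / 2)
    have hw3' : 2 * w - 1 ≠ 1 := fun h => hw.2.1 (by linear_combination h / 2)
    have d1 : DifferentiableAt ℂ (fun s : ℂ => ((z.im : ℝ) : ℂ) ^ s) w :=
      differentiableAt_id.const_cpow (Or.inl hyc)
    have d2 : DifferentiableAt ℂ (fun s : ℂ => ((z.im : ℝ) : ℂ) ^ (1 - s)) w :=
      (differentiableAt_const _ |>.sub differentiableAt_id).const_cpow (Or.inl hyc)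
    have d3 : DifferentiableAt ℂ (fun s : ℂ => completedRiemannZeta (2 * s)) w :=
      (differentiableAt_completedZeta hw2 hw2').comp w (differentiableAt_id.const_mul _)
    have d4 : DifferentiableAt ℂ (fun s : ℂ => completedRiemannZeta (2 * s - 1)) w :=
      (differentiableAt_completedZeta hw3 hw3').comp w ((differentiableAt_id.const_mul _).sub (differentiableAt_const _))
    have d5 : DifferentiableAt ℂ (csH z) w := differentiable_csH z w
    exact ((d3.mul d1).add (d4.mul d2)).add ((differentiableAt_const _).mul d5)
  have h2U : (2 : ℂ) ∈ U := ⟨two_ne_zero, by norm_num, by norm_num⟩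
  have hev : completedEisenstein z =ᶠ[𝓝 (2 : ℂ)] G := by
    have hopen : IsOpen {s : ℂ | 1 < s.re} := isOpen_lt continuous_const Complex.continuous_re
    filter_upwards [hopen.mem_nhds (show (2 : ℂ) ∈ {s : ℂ | 1 < s.re} by simp)] with w hw
    exact completedEisenstein_eq_constantTerm_add_of_one_lt z hw
  have heq := hF.eqOn_of_preconnected_of_eventuallyEq hGa isPreconnected_compl_zero_half_one h2U hev
  exact heq ⟨h0, h1, hh⟩

/-! ## `H_z(s)` as a cosine series in `x`; its constant term along the horocycle vanishes -/

section Horocycle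

variable {x y : ℝ}

/-- `|pt x y|² = x² + y²`. [folklore] -/
theorem normSq_pt (hy : 0 < y) (x : ℝ) : Complex.normSq ((pt x y : ℍ) : ℂ) = x ^ 2 + y ^ 2 := by
  rw [Complex.normSq_apply, UpperHalfPlane.coe_re, UpperHalfPlane.coe_im, pt_re hy, pt_im hy]
  ring

/-- The form attached to `x + iy` is `(1, 2x, x² + y²)`, positive definite. [folklore] -/
theorem isPosDefForm_pt (hy : 0 < y) (x : ℝ) : IsPosDefForm 1 (2 * x) (x ^ 2 + y ^ 2) := by
  have h := isPosDefForm_upperHalf (pt x y)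
  rwa [pt_re hy, normSq_pt hy] at h

/-- Its Stark parameter is `k = y`. [folklore] -/
theorem starkK_pt (hy : 0 < y) (x : ℝ) : starkK 1 (2 * x) (x ^ 2 + y ^ 2) = y := by
  have h := starkK_upperHalf (pt x y)
  rwa [pt_re hy, normSq_pt hy, pt_im hy] at h

/-- The `x`-free coefficient `a_n(y, s) = n^{s-½} σ_{1-2s}(n) K_{s-½}(2πny)` of the Fourier expansion.
[cite: Iwaniec2002, (3.29), PDF p. 47] -/
def csCoeff (y : ℝ) (s : ℂ) (n : ℕ) : ℂ :=
  ((n : ℕ) : ℂ) ^ (s - 1 / 2) * sigmaC (1 - 2 * s) n * besselK (s - 1 / 2) ((2 * Real.pi * y * n : ℝ) : ℂ)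

/-- The terms of `H_{x+iy}(s)` are `a_n(y, s) cos(2πnx)`. [cite: Iwaniec2002, (3.29), PDF p. 47] -/
theorem bgHTerm_pt (hy : 0 < y) (x : ℝ) (s : ℂ) (n : ℕ) :
    bgHTerm 1 (2 * x) (x ^ 2 + y ^ 2) s n = csCoeff y s n * (Real.cos (2 * π * n * x) : ℂ) := by
  unfold bgHTerm csCoeff
  rw [starkK_pt hy]
  have e : (n : ℝ) * Real.pi * (2 * x) / 1 = 2 * π * n * x := by ring
  rw [e]
  ring

/-- `H_{x+iy}(s) = 4 Σ_{n ≥ 1} a_n(y, s) cos(2πnx)`. [cite: Iwaniec2002, (3.29), PDF p. 47] -/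
theorem csH_pt (hy : 0 < y) (x : ℝ) (s : ℂ) :
    csH (pt x y) s = 4 * ∑' n : ℕ, csCoeff y s (n + 1) * (Real.cos (2 * π * ((n + 1 : ℕ) : ℝ) * x) : ℂ) := by
  unfold csH bgH
  rw [pt_re hy, normSq_pt hy]
  congr 1
  exact tsum_congr fun n => bgHTerm_pt hy x s (n + 1)

/-- **Uniform majorant in `x`**: on `‖s‖ ≤ R`, `|a_n(y,s) cos(2πnx)| ≤ C(y, R) n^{N(R)} e^{-2πyn}`.
[cite: BatemanGrosswald1964, Theorem 1 (convergence of (4)), p. 370] -/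
theorem norm_bgHTerm_pt_le (hy : 0 < y) (x : ℝ) {R : ℝ} (hR : 0 ≤ R) {s : ℂ} (hs : ‖s‖ ≤ R) {n : ℕ} (hn : 0 < n) :
    ‖bgHTerm 1 (2 * x) (x ^ 2 + y ^ 2) s n‖ ≤
      (Real.exp (2 * Real.pi * y) / 2 * polyaM 0 (2 * Real.pi * y) ((R + 1 / 2 : ℝ) : ℂ)) *
        ((n : ℝ) ^ (⌈R + 1 / 2⌉₊ + 1 + ⌈2 * R + 1⌉₊) * Real.exp (-(2 * Real.pi * y) * n)) := by
  have h := norm_bgHTerm_le_of_norm_le (isPosDefForm_pt hy x) hR hs hn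
  rwa [starkK_pt hy] at h

/-- The majorant is summable over `n ≥ 1`. [folklore] -/
theorem summable_majorant_pt (hy : 0 < y) (R : ℝ) :
    Summable fun n : ℕ => (Real.exp (2 * Real.pi * y) / 2 * polyaM 0 (2 * Real.pi * y) ((R + 1 / 2 : ℝ) : ℂ)) *
      ((((n + 1 : ℕ) : ℕ) : ℝ) ^ (⌈R + 1 / 2⌉₊ + 1 + ⌈2 * R + 1⌉₊) * Real.exp (-(2 * Real.pi * y) * ((n + 1 : ℕ) : ℝ))) :=
  (summable_pow_mul_exp_neg_succ _ (by positivity)).mul_left _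

/-- The shifted terms `x ↦ a_{n+1}(y,s)cos(2π(n+1)x)` are continuous and uniformly summable, so
`x ↦ H_{x+iy}(s)` is continuous. [folklore] -/
theorem continuous_csH_pt (hy : 0 < y) (s : ℂ) : Continuous fun x : ℝ => csH (pt x y) s := by
  have e : (fun x : ℝ => csH (pt x y) s) =
      fun x => 4 * ∑' n : ℕ, bgHTerm 1 (2 * x) (x ^ 2 + y ^ 2) s (n + 1) := by
    funext x; unfold csH bgH; rw [pt_re hy, normSq_pt hy]
  rw [e]
  refine continuous_const.mul ?_
  refine continuous_tsum (fun n => ?_) (summable_majorant_pt hy ‖s‖) (fun n x => ?_)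
  · simp_rw [bgHTerm_pt hy]
    exact continuous_const.mul (Complex.continuous_ofReal.comp (by fun_prop))
  · exact norm_bgHTerm_pt_le hy x (norm_nonneg s) le_rfl (Nat.succ_pos n)

/-- `∫₀¹ cos(2πnx) dx = 0` for `n ≥ 1`. [folklore] -/
theorem intervalIntegral_cos_two_pi_mul {n : ℕ} (hn : 0 < n) :
    ∫ x in (0 : ℝ)..1, Real.cos (2 * π * n * x) = 0 := by
  have hc : (2 * π * n : ℝ) ≠ 0 := by positivity
  rw [intervalIntegral.integral_comp_mul_left (fun u => Real.cos u) hc, integral_cos]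
  simp only [mul_zero, Real.sin_zero, sub_zero, mul_one, smul_eq_mul]
  rw [show (2 : ℝ) * π * n = ((2 * n : ℕ) : ℝ) * π by push_cast; ring, Real.sin_nat_mul_pi, mul_zero]

/-- **The constant term of `H` along the horocycle vanishes**: `∫₀¹ H_{x+iy}(s) dx = 0` (termwise,
by the uniform majorant). [cite: Iwaniec2002, (3.20) & (3.29), PDF pp. 45-47] -/
theorem intervalIntegral_csH_pt (hy : 0 < y) (s : ℂ) : ∫ x in (0 : ℝ)..1, csH (pt x y) s = 0 := by
  set F : ℕ → ℝ → ℂ := fun n x => csCoeff y s (n + 1) * (Real.cos (2 * π * ((n + 1 : ℕ) : ℝ) * x) : ℂ) with hF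
  have hFc : ∀ n, Continuous (F n) := fun n =>
    continuous_const.mul (Complex.continuous_ofReal.comp (by fun_prop))
  have hFb : ∀ n x, ‖F n x‖ ≤ (Real.exp (2 * Real.pi * y) / 2 * polyaM 0 (2 * Real.pi * y) ((‖s‖ + 1 / 2 : ℝ) : ℂ)) *
      ((((n + 1 : ℕ) : ℕ) : ℝ) ^ (⌈‖s‖ + 1 / 2⌉₊ + 1 + ⌈2 * ‖s‖ + 1⌉₊) * Real.exp (-(2 * Real.pi * y) * ((n + 1 : ℕ) : ℝ))) := by
    intro n x
    rw [hF]; dsimp only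
    rw [← bgHTerm_pt hy x s (n + 1)]
    exact norm_bgHTerm_pt_le hy x (norm_nonneg s) le_rfl (Nat.succ_pos n)
  have e : ∀ x, csH (pt x y) s = 4 * ∑' n, F n x := fun x => csH_pt hy x s
  simp_rw [e]
  rw [intervalIntegral.integral_const_mul]
  suffices h : ∫ x in (0 : ℝ)..1, ∑' n, F n x = 0 by rw [h, mul_zero]
  rw [intervalIntegral.integral_of_le zero_le_one, integral_tsum (fun n => (hFc n).aestronglyMeasurable)]
  · refine (tsum_congr fun n => ?_).trans tsum_zero
    rw [← intervalIntegral.integral_of_le zero_le_one]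
    simp only [hF]
    rw [intervalIntegral.integral_const_mul, intervalIntegral.integral_ofReal,
      intervalIntegral_cos_two_pi_mul (Nat.succ_pos n)]
    simp
  · -- `Σ_n ∫₀¹ |F_n| < ∞`
    have hS := summable_majorant_pt hy ‖s‖
    set M : ℕ → ℝ := fun n => (Real.exp (2 * Real.pi * y) / 2 * polyaM 0 (2 * Real.pi * y) ((‖s‖ + 1 / 2 : ℝ) : ℂ)) *
      ((((n + 1 : ℕ) : ℕ) : ℝ) ^ (⌈‖s‖ + 1 / 2⌉₊ + 1 + ⌈2 * ‖s‖ + 1⌉₊) * Real.exp (-(2 * Real.pi * y) * ((n + 1 : ℕ) : ℝ)))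
      with hM
    have hM0 : ∀ n, 0 ≤ M n := fun n => (norm_nonneg _).trans (hFb n 0)
    have hle : ∀ n, ∫⁻ x in Ioc (0 : ℝ) 1, ‖F n x‖ₑ ≤ ENNReal.ofReal (M n) := by
      intro n
      calc ∫⁻ x in Ioc (0 : ℝ) 1, ‖F n x‖ₑ ≤ ∫⁻ _ in Ioc (0 : ℝ) 1, ENNReal.ofReal (M n) := by
            refine lintegral_mono fun x => ?_
            rw [← ofReal_norm]
            exact ENNReal.ofReal_le_ofReal (hFb n x)
        _ = ENNReal.ofReal (M n) := by rw [setLIntegral_const, Real.volume_Ioc, sub_zero, ENNReal.ofReal_one, mul_one]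
    refine ne_top_of_le_ne_top (ENNReal.ofReal_ne_top (r := ∑' n, M n)) ?_
    rw [ENNReal.ofReal_tsum_of_nonneg hM0 hS]
    exact ENNReal.tsum_le_tsum hle

/-- **The constant term of `E*(z, s)`**: `∫₀¹ E*(x + iy, s) dx = Λ(2s) y^s + Λ(2s-1) y^{1-s}` for
`s ∉ {0, ½, 1}` (Iwaniec (3.20) multiplied by `θ(s)`). [cite: Iwaniec2002, (3.20) & (3.24), PDF p. 46] -/
theorem intervalIntegral_completedEisenstein (hy : 0 < y) {s : ℂ} (h0 : s ≠ 0) (h1 : s ≠ 1) (hh : s ≠ 1 / 2) :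
    ∫ x in (0 : ℝ)..1, completedEisenstein (pt x y) s =
      completedRiemannZeta (2 * s) * ((y : ℝ) : ℂ) ^ s + completedRiemannZeta (2 * s - 1) * ((y : ℝ) : ℂ) ^ (1 - s) := by
  have e : ∀ x : ℝ, completedEisenstein (pt x y) s =
      (completedRiemannZeta (2 * s) * ((y : ℝ) : ℂ) ^ s + completedRiemannZeta (2 * s - 1) * ((y : ℝ) : ℂ) ^ (1 - s)) +
        ((Real.sqrt y : ℝ) : ℂ) * csH (pt x y) s := by
    intro x
    rw [completedEisenstein_eq_constantTerm_add (pt x y) h0 h1 hh, pt_im hy]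
  simp_rw [e]
  have hi : IntervalIntegrable (fun x : ℝ => ((Real.sqrt y : ℝ) : ℂ) * csH (pt x y) s) volume 0 1 :=
    (continuous_const.mul (continuous_csH_pt hy s)).intervalIntegrable _ _
  rw [intervalIntegral.integral_add intervalIntegrable_const hi,
    intervalIntegral.integral_const, intervalIntegral.integral_const_mul, intervalIntegral_csH_pt hy, mul_zero,
    add_zero, sub_zero, one_smul]

end Horocycle

/-! ## Exponential smallness of `H_z(s)` on `0 ≤ Re s ≤ 1`, uniformly in `Im s` -/

section Bound

variable {y₀ : ℝ}

/-- Termwise: `|n^{s-½} σ_{1-2s}(n) cos(·) K_{s-½}(2πyn)| ≤ n³ e^{-2πyn}/(2√y)` for `0 ≤ Re s ≤ 1`, `n ≥ 1`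
(`|K_ν(u)| ≤ e^{-u}√(π/2u)` for `|Re ν| ≤ ½`). [folklore] -/
theorem norm_bgHTerm_upperHalf_le (z : ℍ) {s : ℂ} (hs0 : 0 ≤ s.re) (hs1 : s.re ≤ 1) {n : ℕ} (hn : 0 < n) :
    ‖bgHTerm 1 (2 * z.re) (Complex.normSq (z : ℂ)) s n‖ ≤
      (n : ℝ) ^ 3 * Real.exp (-(2 * Real.pi * z.im * n)) / (2 * Real.sqrt z.im) := by
  have hy := z.im_pos
  have hn1 : (1 : ℝ) ≤ n := by exact_mod_cast hn
  have hu : 0 < 2 * Real.pi * z.im * n := by positivity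
  -- the four factors
  have e1 : ‖((n : ℕ) : ℂ) ^ (s - 1 / 2)‖ ≤ n := by
    rw [Complex.norm_natCast_cpow_of_pos hn]
    have : (s - 1 / 2).re = s.re - 1 / 2 := by simp
    rw [this]
    calc (n : ℝ) ^ (s.re - 1 / 2) ≤ (n : ℝ) ^ (1 : ℝ) := Real.rpow_le_rpow_of_exponent_le hn1 (by linarith)
      _ = n := Real.rpow_one _
  have e2 : ‖sigmaC (1 - 2 * s) n‖ ≤ n * (n : ℝ) ^ 1 := by
    refine norm_sigmaC_le_mul_pow _ hn ?_
    have : (1 - 2 * s).re = 1 - 2 * s.re := by simp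
    rw [this, Nat.cast_one, abs_le]
    constructor <;> linarith
  have e3 : ‖(Real.cos (n * Real.pi * (2 * z.re) / 1) : ℂ)‖ ≤ 1 := by
    rw [Complex.norm_real, Real.norm_eq_abs]; exact Real.abs_cos_le_one _
  have e4 : ‖besselK (s - 1 / 2) ((2 * Real.pi * starkK 1 (2 * z.re) (Complex.normSq (z : ℂ)) * n : ℝ) : ℂ)‖ ≤
      Real.exp (-(2 * Real.pi * z.im * n)) / (2 * Real.sqrt z.im) := by
    rw [starkK_upperHalf]
    have hν : |(s - 1 / 2).re| ≤ 1 / 2 := by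
      have : (s - 1 / 2).re = s.re - 1 / 2 := by simp
      rw [this, abs_le]; constructor <;> linarith
    refine (Literature.Barriers.RiemannHypothesis.norm_besselK_le hν hu).trans ?_
    rw [div_eq_mul_inv, mul_comm (2 : ℝ) (Real.sqrt z.im)]
    refine mul_le_mul_of_nonneg_left ?_ (Real.exp_pos _).le
    -- `√(π/(2u)) ≤ 1/(2√y)` for `u = 2πyn ≥ 2πy`
    have h1 : Real.pi / (2 * (2 * Real.pi * z.im * n)) ≤ 1 / (4 * z.im) := by
      rw [div_le_div_iff₀ (by positivity) (by positivity)]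
      nlinarith [Real.pi_pos, hy]
    calc Real.sqrt (Real.pi / (2 * (2 * Real.pi * z.im * n))) ≤ Real.sqrt (1 / (4 * z.im)) := Real.sqrt_le_sqrt h1
      _ = (Real.sqrt z.im * 2)⁻¹ := by
          rw [Real.sqrt_div' _ (by positivity : (0:ℝ) ≤ 4 * z.im), Real.sqrt_one, Real.sqrt_mul' _ hy.le,
            show Real.sqrt 4 = 2 by rw [show (4:ℝ) = 2 ^ 2 by norm_num, Real.sqrt_sq (by norm_num)]]
          ring
  unfold bgHTerm
  rw [norm_mul, norm_mul, norm_mul]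
  have hK0 : 0 ≤ Real.exp (-(2 * Real.pi * z.im * n)) / (2 * Real.sqrt z.im) := by positivity
  calc ‖((n : ℕ) : ℂ) ^ (s - 1 / 2)‖ * ‖sigmaC (1 - 2 * s) n‖ * ‖(Real.cos (n * Real.pi * (2 * z.re) / 1) : ℂ)‖ *
        ‖besselK (s - 1 / 2) ((2 * Real.pi * starkK 1 (2 * z.re) (Complex.normSq (z : ℂ)) * n : ℝ) : ℂ)‖
      ≤ n * (n * (n : ℝ) ^ 1) * 1 * (Real.exp (-(2 * Real.pi * z.im * n)) / (2 * Real.sqrt z.im)) := by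
        gcongr
    _ = (n : ℝ) ^ 3 * Real.exp (-(2 * Real.pi * z.im * n)) / (2 * Real.sqrt z.im) := by ring

/-- The constant `C(y₀) = 2 e^{2πy₀} Σ_{m ≥ 1} m³ e^{-2πy₀ m}`. [folklore] -/
def csHConst (y₀ : ℝ) : ℝ :=
  2 * Real.exp (2 * Real.pi * y₀) * ∑' m : ℕ, (((m + 1 : ℕ) : ℝ) ^ 3 * Real.exp (-(2 * Real.pi * y₀) * ((m + 1 : ℕ) : ℝ)))

/-- `C(y₀) ≥ 0`. [folklore] -/
theorem csHConst_nonneg (y₀ : ℝ) : 0 ≤ csHConst y₀ := by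
  unfold csHConst
  refine mul_nonneg (by positivity) (tsum_nonneg fun m => by positivity)

/-- **`|H_z(s)| ≤ C(y₀) e^{-2πy}/√y`** for `y = Im z ≥ y₀ > 0` and `0 ≤ Re s ≤ 1`, uniformly in `Im s`
and in `Re z` (Bateman–Grosswald (8) in cruder but `Im s`-uniform form). [cite: Iwaniec2002, (3.29) & p. 47; BatemanGrosswald1964, Theorem 2 (8)] -/
theorem norm_csH_le (hy₀ : 0 < y₀) (z : ℍ) (hz : y₀ ≤ z.im) {s : ℂ} (hs0 : 0 ≤ s.re) (hs1 : s.re ≤ 1) :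
    ‖csH z s‖ ≤ csHConst y₀ * Real.exp (-(2 * Real.pi * z.im)) / Real.sqrt z.im := by
  have hy := z.im_pos
  set κ := 2 * Real.pi * y₀ with hκ
  have hκ0 : 0 < κ := by positivity
  set g : ℕ → ℝ := fun m => ((m + 1 : ℕ) : ℝ) ^ 3 * Real.exp (-κ * ((m + 1 : ℕ) : ℝ)) with hg
  have hgs : Summable g := summable_pow_mul_exp_neg_succ 3 hκ0
  -- termwise bound by `e^{-2πy} e^{κ} g(m) / (2√y)`
  have hterm : ∀ m : ℕ, ‖bgHTerm 1 (2 * z.re) (Complex.normSq (z : ℂ)) s (m + 1)‖ ≤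
      Real.exp (-(2 * Real.pi * z.im)) * Real.exp κ / (2 * Real.sqrt z.im) * g m := by
    intro m
    refine (norm_bgHTerm_upperHalf_le z hs0 hs1 (Nat.succ_pos m)).trans ?_
    have hm0 : (0 : ℝ) ≤ m := Nat.cast_nonneg m
    have e : Real.exp (-(2 * Real.pi * z.im * ((m + 1 : ℕ) : ℝ))) =
        Real.exp (-(2 * Real.pi * z.im)) * Real.exp (-(2 * Real.pi * z.im * m)) := by
      rw [← Real.exp_add]; congr 1; push_cast; ring
    have e' : Real.exp κ * g m = ((m + 1 : ℕ) : ℝ) ^ 3 * Real.exp (-(κ * m)) := by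
      rw [hg]; dsimp only
      rw [show -κ * ((m + 1 : ℕ) : ℝ) = -(κ * m) + -κ by push_cast; ring, Real.exp_add]
      have : Real.exp κ * Real.exp (-κ) = 1 := by rw [← Real.exp_add, add_neg_cancel, Real.exp_zero]
      linear_combination (((m + 1 : ℕ) : ℝ) ^ 3 * Real.exp (-(κ * m))) * this
    have hexp : Real.exp (-(2 * Real.pi * z.im * m)) ≤ Real.exp (-(κ * m)) := by
      rw [Real.exp_le_exp, hκ, neg_le_neg_iff]
      have : 2 * Real.pi * y₀ * m ≤ 2 * Real.pi * z.im * m := by gcongr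
      linarith
    rw [e, show Real.exp (-(2 * Real.pi * z.im)) * Real.exp κ / (2 * Real.sqrt z.im) * g m =
      Real.exp (-(2 * Real.pi * z.im)) * (Real.exp κ * g m) / (2 * Real.sqrt z.im) by ring, e']
    rw [div_le_div_iff_of_pos_right (by positivity)]
    calc ((m + 1 : ℕ) : ℝ) ^ 3 * (Real.exp (-(2 * Real.pi * z.im)) * Real.exp (-(2 * Real.pi * z.im * m)))
        = Real.exp (-(2 * Real.pi * z.im)) * (((m + 1 : ℕ) : ℝ) ^ 3 * Real.exp (-(2 * Real.pi * z.im * m))) := by ring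
      _ ≤ Real.exp (-(2 * Real.pi * z.im)) * (((m + 1 : ℕ) : ℝ) ^ 3 * Real.exp (-(κ * m))) := by gcongr
  have hsum : Summable fun m : ℕ => ‖bgHTerm 1 (2 * z.re) (Complex.normSq (z : ℂ)) s (m + 1)‖ :=
    Summable.of_nonneg_of_le (fun _ => norm_nonneg _) hterm (hgs.mul_left _)
  unfold csH bgH
  rw [norm_mul, show ‖(4 : ℂ)‖ = 4 by norm_num]
  calc 4 * ‖∑' m : ℕ, bgHTerm 1 (2 * z.re) (Complex.normSq (z : ℂ)) s (m + 1)‖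
      ≤ 4 * ∑' m : ℕ, ‖bgHTerm 1 (2 * z.re) (Complex.normSq (z : ℂ)) s (m + 1)‖ := by
        gcongr; exact norm_tsum_le_tsum_norm hsum
    _ ≤ 4 * ∑' m : ℕ, Real.exp (-(2 * Real.pi * z.im)) * Real.exp κ / (2 * Real.sqrt z.im) * g m := by
        exact mul_le_mul_of_nonneg_left (Summable.tsum_le_tsum hterm hsum (hgs.mul_left _)) (by norm_num)
    _ = csHConst y₀ * Real.exp (-(2 * Real.pi * z.im)) / Real.sqrt z.im := by
        rw [tsum_mul_left, csHConst, hg, hκ]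
        field_simp
        ring

/-- In particular `|√y H_z(s)| ≤ C(y₀) e^{-2πy}`. [folklore] -/
theorem norm_sqrt_mul_csH_le (hy₀ : 0 < y₀) (z : ℍ) (hz : y₀ ≤ z.im) {s : ℂ} (hs0 : 0 ≤ s.re) (hs1 : s.re ≤ 1) :
    ‖((Real.sqrt z.im : ℝ) : ℂ) * csH z s‖ ≤ csHConst y₀ * Real.exp (-(2 * Real.pi * z.im)) := by
  have hy := z.im_pos
  have hsq : 0 < Real.sqrt z.im := Real.sqrt_pos.mpr hy
  rw [norm_mul, Complex.norm_real, Real.norm_eq_abs, abs_of_pos hsq]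
  calc Real.sqrt z.im * ‖csH z s‖ ≤ Real.sqrt z.im * (csHConst y₀ * Real.exp (-(2 * Real.pi * z.im)) / Real.sqrt z.im) := by
        gcongr; exact norm_csH_le hy₀ z hz hs0 hs1
    _ = csHConst y₀ * Real.exp (-(2 * Real.pi * z.im)) := by field_simp

end Bound

/-! ## The scattering coefficient `φ(s) = Λ(2s-1)/Λ(2s)` -/

section Scattering

/-- **The scattering coefficient of `SL₂(ℤ)`**, `φ(s) = θ(1-s)/θ(s) = Λ(2s-1)/Λ(2s)`
(`= √π Γ(s-½)ζ(2s-1)/(Γ(s)ζ(2s))`, Iwaniec (3.24)), written through the entire function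
`θ̂(s) = 2s(1-2s)Λ₀(2s) - 1 = 2s(1-2s)Λ(2s)` of `ModularEisensteinCriticalLine.lean` so that it is
holomorphic at `s = ½` (value `φ(½) = -1`) and has its pole at `s = 1` visible: `φ(s) = s θ̂(1-s)/((s-1) θ̂(s))`.
[cite: Iwaniec2002, (3.24)-(3.25), PDF p. 46] -/
def scatPhi (s : ℂ) : ℂ := s * thetaHat (1 - s) / ((s - 1) * thetaHat s)

/-- `θ̂(s̄) = conj θ̂(s)`. [folklore] -/
theorem thetaHat_conj (s : ℂ) : thetaHat (conj s) = conj (thetaHat s) := by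
  unfold thetaHat
  have h2 : conj (2 : ℂ) = 2 := map_ofNat _ 2
  rw [show 2 * conj s = conj (2 * s) by rw [map_mul, h2], Literature.NumberTheory.LFunctions.completedRiemannZeta₀_conj]
  simp [h2]

/-- `θ̂(0) = -1`. [folklore] -/
theorem thetaHat_zero : thetaHat 0 = -1 := by
  unfold thetaHat; norm_num

/-- `θ̂(1) = -π/3` (`Λ(2) = π/6`). [folklore] -/
theorem thetaHat_one : thetaHat 1 = -(π : ℂ) / 3 := by
  rw [thetaHat_eq one_ne_zero (by norm_num), mul_one, completedRiemannZeta_two']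
  ring

/-- **`φ(s) = Λ(2s-1)/Λ(2s)`** away from `s = 0, ½, 1`. [cite: Iwaniec2002, (3.24), PDF p. 46] -/
theorem scatPhi_eq {s : ℂ} (h0 : s ≠ 0) (h1 : s ≠ 1) (hh : s ≠ 1 / 2) :
    scatPhi s = completedRiemannZeta (2 * s - 1) / completedRiemannZeta (2 * s) := by
  unfold scatPhi
  have h1' : 1 - s ≠ 0 := sub_ne_zero.mpr (Ne.symm h1)
  have hh' : 1 - s ≠ 1 / 2 := fun h => hh (by linear_combination -h)
  rw [thetaHat_eq h1' hh', thetaHat_eq h0 hh, show 2 * (1 - s) = 1 - (2 * s - 1) by ring,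
    completedRiemannZeta_one_sub]
  have hs1 : s - 1 ≠ 0 := sub_ne_zero.mpr h1
  have h2 : (1 - 2 * s) ≠ 0 := fun h => hh (by linear_combination -h / 2)
  by_cases hΛ : completedRiemannZeta (2 * s) = 0
  · rw [hΛ]; simp
  · rw [div_eq_div_iff (mul_ne_zero hs1 (mul_ne_zero (mul_ne_zero (mul_ne_zero two_ne_zero h0) h2) hΛ)) hΛ]
    ring

/-- `φ` is holomorphic wherever `s ≠ 1` and `θ̂(s) ≠ 0`. [folklore] -/
theorem differentiableAt_scatPhi {s : ℂ} (h1 : s ≠ 1) (hθ : thetaHat s ≠ 0) : DifferentiableAt ℂ scatPhi s := by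
  unfold scatPhi
  refine DifferentiableAt.div (differentiableAt_id.mul ?_) ((differentiableAt_id.sub_const 1).mul
    (differentiable_thetaHat s)) (mul_ne_zero (sub_ne_zero.mpr h1) hθ)
  exact (differentiable_thetaHat (1 - s)).comp s ((differentiableAt_const _).sub differentiableAt_id)

/-- `θ̂(s) ≠ 0` for `Re s ≥ ½` (`ζ ≠ 0` on `Re ≥ 1`; at `s = ½` the value is `-1`). [folklore] -/
theorem thetaHat_ne_zero_of_half_le_re {s : ℂ} (hs : 1 / 2 ≤ s.re) : thetaHat s ≠ 0 := by
  by_cases hh : s = 1 / 2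
  · rw [hh, thetaHat_half]; norm_num
  have h0 : s ≠ 0 := fun h => by rw [h, Complex.zero_re] at hs; linarith
  rw [thetaHat_eq h0 hh]
  have h2 : (1 - 2 * s) ≠ 0 := fun h => hh (by linear_combination -h / 2)
  exact mul_ne_zero (mul_ne_zero (mul_ne_zero two_ne_zero h0) h2) (completedRiemannZeta_two_mul_ne_zero hs hh)

/-- **`φ` is holomorphic on `{Re s ≥ ½} ∖ {1}`** (in particular on the line `Re s = ½`, including
`s = ½`). [cite: Iwaniec2002, §6.3 & (3.24), PDF pp. 46, 88] -/
theorem differentiableAt_scatPhi_of_half_le_re {s : ℂ} (hs : 1 / 2 ≤ s.re) (h1 : s ≠ 1) :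
    DifferentiableAt ℂ scatPhi s :=
  differentiableAt_scatPhi h1 (thetaHat_ne_zero_of_half_le_re hs)

/-- `φ(½) = -1`. [cite: Iwaniec2002, p. 47 ("E(z, 1/2) ≡ 0")] -/
theorem scatPhi_half : scatPhi (1 / 2) = -1 := by
  unfold scatPhi
  rw [show (1 : ℂ) - 1 / 2 = 1 / 2 by norm_num, thetaHat_half]
  norm_num

/-- `φ(s̄) = conj φ(s)`. [folklore] -/
theorem scatPhi_conj (s : ℂ) : scatPhi (conj s) = conj (scatPhi s) := by
  unfold scatPhi
  rw [show 1 - conj s = conj (1 - s) by simp, thetaHat_conj, thetaHat_conj]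
  simp

/-- **The functional equation `φ(s)φ(1-s) = 1`** (where both are defined). [cite: Iwaniec2002, (6.24), PDF p. 88] -/
theorem scatPhi_mul_scatPhi_one_sub {s : ℂ} (h0 : s ≠ 0) (h1 : s ≠ 1) (hθ : thetaHat s ≠ 0)
    (hθ' : thetaHat (1 - s) ≠ 0) : scatPhi s * scatPhi (1 - s) = 1 := by
  unfold scatPhi
  rw [sub_sub_cancel]
  have hs1 : s - 1 ≠ 0 := sub_ne_zero.mpr h1
  have hs1' : (1 - s) - 1 ≠ 0 := by rw [sub_sub_cancel_left]; exact neg_ne_zero.mpr h0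
  field_simp
  ring

/-- `s(r) = ½ + ir` has conjugate `s(-r) = 1 - s(r)`. [folklore] -/
theorem conj_critS (r : ℝ) : conj (critS r) = critS (-r) := by
  unfold critS
  have h2 : conj (2 : ℂ) = 2 := map_ofNat _ 2
  simp only [map_add, map_div₀, map_one, map_mul, Complex.conj_I, Complex.conj_ofReal, Complex.ofReal_neg, h2]
  ring

/-- `1 - s(r) = s(-r)`. [folklore] -/
theorem one_sub_critS (r : ℝ) : 1 - critS r = critS (-r) := by
  unfold critS; push_cast; ring

/-- **`|φ(½ + ir)| = 1`**: `φ` is unitary on the critical line. [cite: Iwaniec2002, (6.26), PDF p. 88] -/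
theorem norm_scatPhi_critS (r : ℝ) : ‖scatPhi (critS r)‖ = 1 := by
  have hθ : ∀ r : ℝ, thetaHat (critS r) ≠ 0 := fun r => thetaHat_critS_ne_zero r
  have h := scatPhi_mul_scatPhi_one_sub (critS_ne_zero r) (critS_ne_one r) (hθ r)
    (by rw [one_sub_critS]; exact hθ (-r))
  rw [one_sub_critS, ← conj_critS, scatPhi_conj, Complex.mul_conj, ← Complex.ofReal_one, Complex.ofReal_inj,
    Complex.normSq_eq_norm_sq] at h
  nlinarith [norm_nonneg (scatPhi (critS r))]

/-- `φ(½ - ir) = conj φ(½ + ir)`. [folklore] -/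
theorem scatPhi_critS_neg (r : ℝ) : scatPhi (critS (-r)) = conj (scatPhi (critS r)) := by
  rw [← conj_critS, scatPhi_conj]

/-- The regular part `φ̃(s) = (s - 1)φ(s) = s θ̂(1-s)/θ̂(s)` of `φ` at `s = 1`. [folklore] -/
def scatPhiReg (s : ℂ) : ℂ := s * thetaHat (1 - s) / thetaHat s

/-- `φ(s) = φ̃(s)/(s - 1)`. [folklore] -/
theorem scatPhi_eq_scatPhiReg_div (s : ℂ) : scatPhi s = scatPhiReg s / (s - 1) := by
  unfold scatPhi scatPhiReg
  rw [mul_comm (s - 1), div_div]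

/-- `φ̃` is holomorphic wherever `θ̂ ≠ 0`, in particular on `Re s ≥ ½`. [folklore] -/
theorem differentiableAt_scatPhiReg {s : ℂ} (hθ : thetaHat s ≠ 0) : DifferentiableAt ℂ scatPhiReg s := by
  unfold scatPhiReg
  refine DifferentiableAt.div (differentiableAt_id.mul ?_) (differentiable_thetaHat s) hθ
  exact (differentiable_thetaHat (1 - s)).comp s ((differentiableAt_const _).sub differentiableAt_id)

/-- **The residue of `φ` at `s = 1` is `3/π = 1/vol(𝒟)`**: `φ̃(1) = θ̂(0)/θ̂(1) = 3/π`.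
[cite: Iwaniec2002, (6.33) & (3.26), PDF pp. 47, 90] -/
theorem scatPhiReg_one : scatPhiReg 1 = 3 / π := by
  unfold scatPhiReg
  rw [sub_self, thetaHat_zero, thetaHat_one]
  have hπ : (π : ℂ) ≠ 0 := by exact_mod_cast Real.pi_pos.ne'
  field_simp

end Scattering

/-! ## `E(z, 1/2 + ir)`: constant term `y^{½+ir} + φ(½+ir) y^{½-ir}` and the remainder -/

section CriticalLine

variable {y y₀ : ℝ}

/-- `c(0) = 0` (so `E(z, ½) ≡ 0` in this normalisation). [folklore] -/
theorem critFactor_zero : critFactor 0 = 0 := by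
  unfold critFactor critS
  simp

/-- `s(r) ≠ ½` for `r ≠ 0`. [folklore] -/
theorem critS_ne_half {r : ℝ} (hr : r ≠ 0) : critS r ≠ 1 / 2 := by
  intro h; have := congrArg Complex.im h; simp [critS, hr] at this

/-- `c(r) = 1/Λ(1 + 2ir)` for `r ≠ 0`. [folklore] -/
theorem critFactor_eq_inv {r : ℝ} (hr : r ≠ 0) : critFactor r = (completedRiemannZeta (2 * critS r))⁻¹ := by
  unfold critFactor
  have h0 := critS_ne_zero r
  have hh := critS_ne_half hr
  rw [thetaHat_eq h0 hh]
  have hΛ := completedRiemannZeta_two_mul_ne_zero (s := critS r) (by simp [critS]) hh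
  have h2 : (1 - 2 * critS r) ≠ 0 := fun h => hh (by linear_combination -h / 2)
  field_simp

/-- `c(-r) = conj c(r)`. [folklore] -/
theorem critFactor_neg (r : ℝ) : critFactor (-r) = conj (critFactor r) := by
  unfold critFactor
  have h2 : conj (2 : ℂ) = 2 := map_ofNat _ 2
  rw [← conj_critS, thetaHat_conj]
  simp only [map_mul, map_div₀, map_sub, map_one, h2]

/-- **The constant term of `E(z, 1/2 + ir)` along the horocycle at height `y`**:
`e(y, r) = c(r)[Λ(1+2ir) y^{½+ir} + Λ(2ir) y^{½-ir}]` (`= y^{½+ir} + φ(½+ir) y^{½-ir}` for `r ≠ 0`,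
`= 0` for `r = 0`). [cite: Iwaniec2002, (3.20), PDF p. 46] -/
def eisCT (y r : ℝ) : ℂ :=
  critFactor r * (completedRiemannZeta (2 * critS r) * ((y : ℝ) : ℂ) ^ (critS r) +
    completedRiemannZeta (2 * critS r - 1) * ((y : ℝ) : ℂ) ^ (1 - critS r))

/-- **The non-constant part** `N(z, r) = c(r) √y H_z(½ + ir)` of `E(z, 1/2 + ir)`. [cite: Iwaniec2002, (3.29), PDF p. 47] -/
def eisRem (z : ℍ) (r : ℝ) : ℂ := critFactor r * (((Real.sqrt z.im : ℝ) : ℂ) * csH z (critS r))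

/-- **`E(z, ½ + ir) = e(y, r) + N(z, r)`** for every real `r`. [cite: Iwaniec2002, (3.20) & (3.29), PDF pp. 46-47] -/
theorem eisensteinCrit_eq_eisCT_add_eisRem (z : ℍ) (r : ℝ) : eisensteinCrit z r = eisCT z.im r + eisRem z r := by
  by_cases hr : r = 0
  · subst hr
    simp [eisensteinCrit, eisCT, eisRem, critFactor_zero]
  · unfold eisensteinCrit eisCT eisRem
    rw [completedEisenstein_eq_constantTerm_add z (critS_ne_zero r) (critS_ne_one r) (critS_ne_half hr)]
    ring

/-- `e(y, r) = y^{s} + φ(s) y^{1-s}`, `s = ½ + ir`, for `r ≠ 0`. [cite: Iwaniec2002, (3.20), PDF p. 46] -/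
theorem eisCT_eq {r : ℝ} (hr : r ≠ 0) (y : ℝ) :
    eisCT y r = ((y : ℝ) : ℂ) ^ (critS r) + scatPhi (critS r) * ((y : ℝ) : ℂ) ^ (1 - critS r) := by
  unfold eisCT
  rw [critFactor_eq_inv hr, scatPhi_eq (critS_ne_zero r) (critS_ne_one r) (critS_ne_half hr)]
  have hΛ := completedRiemannZeta_two_mul_ne_zero (s := critS r) (by simp [critS]) (critS_ne_half hr)
  field_simp

/-- `e(y, 0) = 0`. [folklore] -/
theorem eisCT_zero (y : ℝ) : eisCT y 0 = 0 := by
  simp [eisCT, critFactor_zero]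

/-- `|y^{s(r)}| = |y^{1-s(r)}| = √y`. [folklore] -/
theorem norm_cpow_critS (hy : 0 < y) (r : ℝ) : ‖((y : ℝ) : ℂ) ^ (critS r)‖ = Real.sqrt y := by
  rw [Complex.norm_cpow_eq_rpow_re_of_pos hy, show (critS r).re = 1 / 2 by simp [critS], Real.sqrt_eq_rpow]

/-- `|y^{1-s(r)}| = √y`. [folklore] -/
theorem norm_cpow_one_sub_critS (hy : 0 < y) (r : ℝ) : ‖((y : ℝ) : ℂ) ^ (1 - critS r)‖ = Real.sqrt y := by
  rw [one_sub_critS, norm_cpow_critS hy]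

/-- **`|e(y, r)| ≤ 2√y`** (`|φ| = 1` on the line). [cite: Iwaniec2002, (3.20) & (6.26), PDF pp. 46, 88] -/
theorem norm_eisCT_le (hy : 0 < y) (r : ℝ) : ‖eisCT y r‖ ≤ 2 * Real.sqrt y := by
  by_cases hr : r = 0
  · rw [hr, eisCT_zero, norm_zero]; positivity
  rw [eisCT_eq hr]
  refine (norm_add_le _ _).trans ?_
  rw [norm_mul, norm_scatPhi_critS, one_mul, norm_cpow_critS hy, norm_cpow_one_sub_critS hy]
  linarith

/-- **`|N(z, r)| ≤ |c(r)| C(y₀) e^{-2πy}`** for `Im z ≥ y₀ > 0`, all real `r`. [cite: Iwaniec2002, (3.29), PDF p. 47] -/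
theorem norm_eisRem_le (hy₀ : 0 < y₀) (z : ℍ) (hz : y₀ ≤ z.im) (r : ℝ) :
    ‖eisRem z r‖ ≤ ‖critFactor r‖ * (csHConst y₀ * Real.exp (-(2 * Real.pi * z.im))) := by
  unfold eisRem
  rw [norm_mul]
  refine mul_le_mul_of_nonneg_left ?_ (norm_nonneg _)
  exact norm_sqrt_mul_csH_le hy₀ z hz (by simp [critS]) (by norm_num [critS])

/-- **`|E(z, ½ + ir)| ≤ 2√y + |c(r)| C(y₀) e^{-2πy}`** for `Im z ≥ y₀`: polynomial (indeed `√y`)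
growth in the cusp, locally uniformly in `r` (`c` is continuous). [cite: Iwaniec2002, (3.20) & (3.29), PDF pp. 46-47] -/
theorem norm_eisensteinCrit_le (hy₀ : 0 < y₀) (z : ℍ) (hz : y₀ ≤ z.im) (r : ℝ) :
    ‖eisensteinCrit z r‖ ≤ 2 * Real.sqrt z.im + ‖critFactor r‖ * (csHConst y₀ * Real.exp (-(2 * Real.pi * z.im))) := by
  rw [eisensteinCrit_eq_eisCT_add_eisRem]
  exact (norm_add_le _ _).trans (add_le_add (norm_eisCT_le z.im_pos r) (norm_eisRem_le hy₀ z hz r))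

/-- **The constant term of `E(·, ½ + ir)` along the horocycle**: `∫₀¹ E(x + iy, ½ + ir) dx = e(y, r)`.
[cite: Iwaniec2002, (3.20), PDF p. 46] -/
theorem intervalIntegral_eisensteinCrit (hy : 0 < y) (r : ℝ) :
    ∫ x in (0 : ℝ)..1, eisensteinCrit (pt x y) r = eisCT y r := by
  by_cases hr : r = 0
  · subst hr
    simp [eisensteinCrit, critFactor_zero, eisCT_zero]
  unfold eisensteinCrit eisCT
  rw [intervalIntegral.integral_const_mul,
    intervalIntegral_completedEisenstein hy (critS_ne_zero r) (critS_ne_one r) (critS_ne_half hr)]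

/-- `E*(z, s̄) = conj E*(z, s)` (the theta series is real). [folklore] -/
theorem completedEisenstein_conj (z : ℍ) (s : ℂ) : completedEisenstein z (conj s) = conj (completedEisenstein z s) := by
  rw [completedEisenstein_eq, completedEisenstein_eq]
  unfold completedEisenstein₀
  rw [WeakFEPair.Λ₀, Literature.Barriers.RiemannHypothesis.mellin_conj
    (Literature.Barriers.RiemannHypothesis.conj_f_modif_thetaFEPair z) s]
  have h2 : conj (2 : ℂ) = 2 := map_ofNat _ 2
  simp [h2]

/-- **`E(z, ½ - ir) = conj E(z, ½ + ir)`.** [folklore] -/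
theorem eisensteinCrit_neg (z : ℍ) (r : ℝ) : eisensteinCrit z (-r) = conj (eisensteinCrit z r) := by
  unfold eisensteinCrit
  rw [critFactor_neg, ← conj_critS, completedEisenstein_conj, map_mul]

end CriticalLine

end Literature.NumberTheory.Automorphic
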